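import Mathlib.Probability.ProbabilityMassFunction.Constructions
import Mathlib.Probability.Distributions.Uniform
import Mathlib.Analysis.Asymptotics.SuperpolynomialDecay
import Mathlib.Data.Fintype.Vector
import HarnessLib

-- provenance: harness21/H21/H21/Prelude/CryptoQuantFine/StatisticalDistance.lean @ e1a0f7a (interim HEAD d8f2665); M5 mechanical rewrite
/-!
# Statistical (total variation) distance and probability ensembles

Trunk: CryptoQuantFine, concept C1 (realises the notion `statistical_distance`).

We define the statistical distance (total variation distance) between two probability mass
functions, the uniform distribution `U_n` on `n`-bit strings, probability ensembles indexed by a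
security parameter, and the relation "statistically close" (negligible statistical distance),
following Goldreich, *Foundations of Cryptography* vol. 1 (2001), §3.2.1–3.2.2 and §1.3.

## Main definitions

* `PMF.tvDist p q`: `Δ(p, q) = ½ ∑ₐ |p a - q a|` as a real number. This is a deliberate
  dot-notation extension placed in Mathlib's `PMF` namespace (Mathlib has no total variation
  distance for `PMF` at the pinned version; grep for `tvDist`/`totalVariation` finds nothing).
* `Literature.CryptoQuantFine.uniformBits n`: the uniform distribution on `List Bool` strings of length `n`,
  as the push-forward of `PMF.uniformOfFintype (List.Vector Bool n)`.
* `Literature.CryptoQuantFine.Ensemble α`: `ℕ → PMF α`.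
* `Literature.CryptoQuantFine.uniformEnsemble ℓ`: `n ↦ U_{ℓ n}`.
* `Literature.CryptoQuantFine.IsStatisticallyClose X Y`: `n ↦ Δ(X n, Y n)` is negligible, phrased with
  Mathlib's `Asymptotics.SuperpolynomialDecay` (definitionally the Wave0 notion of negligible).
* `Literature.CryptoQuantFine.uniformAvg n g`: the expectation of `g` over `U_n`, as a finite sum.

## Design choices

* `tvDist` is real-valued (via `ENNReal.toReal`); all values `p a` are finite (`≤ 1`) so nothing is
  lost, and real values interact directly with `SuperpolynomialDecay`.
* Bit strings are `List Bool` (matching the trunk's Boolean encodings); the length-`n` slice is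
  indexed by the `Fintype` `List.Vector Bool n`.
-/

open scoped ENNReal
open Filter Asymptotics

namespace PMF

variable {α β : Type*}

/-- The *statistical distance* (total variation distance) between two probability mass functions,
`Δ(p, q) = ½ ∑' a, |p a - q a|`, as a real number.
Dot-notation extension of Mathlib's `PMF` namespace (no Mathlib counterpart at the pinned version).
Goldreich 2001, §3.2.1 (Definition 3.2.1 footnote) and Definition 1.3.3. [cite: Goldreich2001, §3.2.1 (Definition 3.2.1 footnote] -/
noncomputable def tvDist (p q : PMF α) : ℝ :=
  2⁻¹ * ∑' a, |(p a).toReal - (q a).toReal|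

/-- `Δ(p, p) = 0`. Goldreich 2001, §3.2.1. [cite: Goldreich2001, §3.2.1] -/
@[simp]
theorem tvDist_self (p : PMF α) : p.tvDist p = 0 := by
  simp [tvDist]

/-- Statistical distance is symmetric. Goldreich 2001, §3.2.1. [cite: Goldreich2001, §3.2.1] -/
theorem tvDist_comm (p q : PMF α) : p.tvDist q = q.tvDist p := by
  simp [tvDist, abs_sub_comm]

/-- Statistical distance is nonnegative. Goldreich 2001, §3.2.1. [cite: Goldreich2001, §3.2.1] -/
theorem tvDist_nonneg (p q : PMF α) : 0 ≤ p.tvDist q := by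
  unfold tvDist
  positivity

/-- Statistical distance is at most `1`. Goldreich 2001, §3.2.1. [cite: Goldreich2001, §3.2.1] -/
def tvDist_le_one : Prop :=
  ∀ (p q : PMF α),
    p.tvDist q ≤ 1

/-- Triangle inequality for statistical distance. Goldreich 2001, §3.2.1. [cite: Goldreich2001, §3.2.1] -/
def tvDist_triangle : Prop :=
  ∀ (p q r : PMF α),
    p.tvDist r ≤ p.tvDist q + q.tvDist r

/-- The statistical distance equals the largest difference in probability of an event:
`Δ(p, q) = sup_S (p S - q S)`. Goldreich 2001, §3.2.1 (Exercise 9 of Ch. 3). [cite: Goldreich2001, §3.2.1 (Exercise 9 of Ch. 3] -/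
def tvDist_eq_iSup_measure : Prop :=
  ∀ (p q : PMF α),
    p.tvDist q = ⨆ S : Set α, ((p.toOuterMeasure S).toReal - (q.toOuterMeasure S).toReal)

/-- Data-processing inequality: applying a (deterministic) function cannot increase statistical
distance. Goldreich 2001, §3.2.1 (Exercise 10 of Ch. 3). [cite: Goldreich2001, §3.2.1 (Exercise 10 of Ch. 3] -/
def tvDist_map_le : Prop :=
  ∀ (f : α → β) (p q : PMF α),
    (p.map f).tvDist (q.map f) ≤ p.tvDist q

end PMF

namespace Literature.Computability.Cryptography

variable {α : Type*}

/-- The uniform distribution `U_n` on bit strings of length `n`, as a `PMF (List Bool)` supported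
on lists of length `n`: the push-forward along `List.Vector.toList` of the uniform distribution on
the finite type `List.Vector Bool n`. Goldreich 2001, §1.3 (notation `U_n`). [cite: Goldreich2001, §1.3 (notation  U_n] -/
noncomputable def uniformBits (n : ℕ) : PMF (List Bool) :=
  (PMF.uniformOfFintype (List.Vector Bool n)).map List.Vector.toList

/-- `U_n` gives mass `2⁻ⁿ` to each string of length `n` and `0` to all other strings.
Goldreich 2001, §1.3. [cite: Goldreich2001, §1.3] -/
def uniformBits_apply : Prop :=
  ∀ (n : ℕ) (x : List Bool),
    uniformBits n x = if x.length = n then (2⁻¹ : ℝ≥0∞) ^ n else 0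

/-- A *probability ensemble* over `α`: a sequence of distributions indexed by the security
parameter `n : ℕ`. Goldreich 2001, Definition 3.2.1 (ensembles indexed by `ℕ`). [cite: Goldreich2001, Definition 3.2.1 (ensembles indexed by] -/
abbrev Ensemble (α : Type*) := ℕ → PMF α

/-- The uniform ensemble `n ↦ U_{ℓ(n)}` for a length function `ℓ`. Goldreich 2001, §3.2.2 and
Definition 3.3.1. [cite: Goldreich2001, §3.2.2 and Definition 3.3.1] -/
noncomputable def uniformEnsemble (ℓ : ℕ → ℕ) : Ensemble (List Bool) :=
  fun n => uniformBits (ℓ n)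

/-- Two ensembles are *statistically close* (statistically indistinguishable) if their statistical
distance `n ↦ Δ(X n, Y n)` is a negligible function of `n`, i.e. decays faster than any inverse
polynomial (`Asymptotics.SuperpolynomialDecay` along `atTop` with parameter `n ↦ (n : ℝ)`).
Goldreich 2001, Definition 3.2.4 (statistical closeness, §3.2.1/§3.2.2). [cite: Goldreich2001, Definition 3.2.4 (statistical closeness] -/
def IsStatisticallyClose (X Y : Ensemble α) : Prop :=
  SuperpolynomialDecay atTop (fun n : ℕ => (n : ℝ)) (fun n => (X n).tvDist (Y n))

/-- Statistical closeness is reflexive. Goldreich 2001, §3.2.2. [cite: Goldreich2001, §3.2.2] -/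
theorem IsStatisticallyClose.refl (X : Ensemble α) : IsStatisticallyClose X X := by
  simp only [IsStatisticallyClose, PMF.tvDist_self]
  exact superpolynomialDecay_zero atTop (fun n : ℕ => (n : ℝ))

/-- Statistical closeness is symmetric. Goldreich 2001, §3.2.2. [cite: Goldreich2001, §3.2.2] -/
theorem IsStatisticallyClose.symm {X Y : Ensemble α} (h : IsStatisticallyClose X Y) :
    IsStatisticallyClose Y X := by
  simpa [IsStatisticallyClose, PMF.tvDist_comm] using h

/-- Statistical closeness is transitive (by the triangle inequality and closure of negligible
functions under addition). Goldreich 2001, §3.2.2. [cite: Goldreich2001, §3.2.2] -/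
def IsStatisticallyClose.trans : Prop :=
  ∀ {X Y Z : Ensemble α} (hXY : IsStatisticallyClose X Y) (hYZ : IsStatisticallyClose Y Z),
    IsStatisticallyClose X Z

/-- The expectation of `g : List Bool → ℝ` under the uniform distribution `U_n` on `n`-bit strings,
written as the finite average `(∑_{x ∈ {0,1}ⁿ} g x) / 2ⁿ`. Goldreich 2001, §1.3 / §2.2
(probabilities "taken over `U_n`"). [cite: Goldreich2001, §1.3 / §2.2 (probabilities "taken over] -/
noncomputable def uniformAvg (n : ℕ) (g : List Bool → ℝ) : ℝ :=
  (∑ x : List.Vector Bool n, g x.toList) / 2 ^ n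

/-- The uniform average of a nonnegative function is nonnegative. [folklore] -/
theorem uniformAvg_nonneg {n : ℕ} {g : List Bool → ℝ} (hg : ∀ x, 0 ≤ g x) :
    0 ≤ uniformAvg n g := by
  unfold uniformAvg
  exact div_nonneg (Finset.sum_nonneg fun x _ => hg _) (by positivity)

/-- The uniform average of a function bounded by `1` is at most `1`. [folklore] -/
theorem uniformAvg_le_one {n : ℕ} {g : List Bool → ℝ} (hg : ∀ x, g x ≤ 1) :
    uniformAvg n g ≤ 1 := by
  unfold uniformAvg
  rw [div_le_one (by positivity)]
  calc (∑ x : List.Vector Bool n, g x.toList) ≤ ∑ _x : List.Vector Bool n, (1 : ℝ) :=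
        Finset.sum_le_sum fun x _ => hg _
    _ = 2 ^ n := by simp [card_vector]

/-- The uniform average of `g` is its expectation under `uniformBits n`: for an indicator `g = 𝟙_S`
it is the `uniformBits n`-measure of `S`. Goldreich 2001, §1.3. [cite: Goldreich2001, §1.3] -/
def uniformAvg_indicator_eq_toOuterMeasure : Prop :=
  ∀ (n : ℕ) (S : Set (List Bool)) [DecidablePred (· ∈ S)],
    uniformAvg n (fun x => if x ∈ S then 1 else 0) = ((uniformBits n).toOuterMeasure S).toReal

end Literature.Computability.Cryptography

/-! ## Discharged facts -/

namespace Literature.Computability.Cryptography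

/-- Discharge of `uniformBits_apply`: `Pr[U_n = α]` equals `2⁻ⁿ` if `α ∈ {0,1}ⁿ` and `0` otherwise.
This is exactly the sentence defining the notation `U_n` in Goldreich, *Foundations of
Cryptography* vol. 1, §1.2.1 "Notational Conventions", paragraph *Typical Random Variables*
(p. 9; the fact's docstring says §1.3, the printed locus is §1.2.1). The proof unfolds the
push-forward `uniformBits n = (uniformOfFintype (List.Vector Bool n)).map toList`: `toList` is
injective with image the length-`n` lists, and `card (List.Vector Bool n) = 2 ^ n`.
[cite: Goldreich2001, §1.2.1 (Typical Random Variables), p. 9] -/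
theorem uniformBits_apply_holds : uniformBits_apply := by
  intro n x
  simp only [uniformBits, PMF.map_apply, PMF.uniformOfFintype_apply, card_vector,
    Fintype.card_bool]
  split_ifs with hx
  · obtain ⟨v, rfl⟩ : ∃ v : List.Vector Bool n, v.toList = x := ⟨⟨x, hx⟩, rfl⟩
    rw [tsum_eq_single v]
    · simp [ENNReal.inv_pow]
    · intro b hb
      rw [if_neg]
      intro h
      exact hb (List.Vector.toList_injective h).symm
  · refine ENNReal.tsum_eq_zero.mpr fun a => ?_
    rw [if_neg]
    intro h
    exact hx (h ▸ a.toList_length)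

end Literature.Computability.Cryptography
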